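import Summits.QuantumFields.GaugeBoot.LoopEquationSpectatorPair
import Summits.QuantumFields.GaugeBoot.PlaquetteGradientIdentity
import HarnessLib

/-!
# Strong coupling from the loop equation, II: the words — edge avoidance, rotation, and the split sums of the deformed plaquettes (gauge-boot, ADDENDUM 22 part C, file 1/2)

HONEST FRAMING (cell `pub-gaugeboot`, page 1 of every file): the venture produces certified bounds
on lattice expectations at stated coupling, gauge group, dimension and torus size; NOT a mass gap,
NOT a continuum limit, NOT a string tension; NOT Yang–Mills-summit-bearing (barriers
`FixedCouplingUltralocality`, `PerturbativeInvisibility`).  Pure word combinatorics on the torus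
`(ℤ/L)^d`, `L ≥ 2`; no number is certified here.

## Content

The second loop-equation step for the plaquette (`StrongCouplingPlaquetteUN/SUN`) needs, for the `2(d−1)` plaquette
words `P̃_{ν,ε}` through the marked edge `e = (x, μ)` and the marked plaquette `P̃₀ = P̃_{ν₀,+}`, the split sums of
the DEFORMED words `P̃₀·P̃_{ν,ε}` and `P̃₀·P̃_{ν,ε}⁻¹` at an edge they traverse ONCE.  That edge is the second letter
of `P̃₀`, `(x + e_μ, ν₀)`; after a cyclic rotation (`trace_wordHolonomy_rotate_aux`, the trace of a closed word is
unchanged when its first letter is moved to the end and the base point along) the deformed word reads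
`+ν₀ −μ −ν₀ · q · +μ` from `x + e_μ` with `q = P̃_{ν,ε}^{±1}`, and its split terms at `(x + e_μ, ν₀)` reduce to the
marked first letter as soon as `q` AVOIDS that edge (`Word.Avoids`: no letter traverses it; `sum_splitTerm_rot`).
This file proves: the avoidance calculus (`Word.avoids_cons/_append`, axis and site criteria decided on one
coordinate of `(ℤ/L)^d`, `L ≥ 2`), the vanishing of split and merge terms at non-traversals, the one-marked-letter
split sum `sum_splitTerm_cons_fwd`, and the four avoidance facts `avoids_plaqWord_true/false(_reverse)` (the
plaquette words through `(x, μ)` other than `P̃₀` avoid `(x + e_μ, ν₀)`), whence `sum_splitTerm_rot`.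

References: Yu. Makeenko, *Methods of contemporary gauge theory* (2002) §12 (iterating the lattice loop
equation); V. Kazakov, Z. Zheng, arXiv:2203.11360 §2.  Everything is `[folklore]`.
-/

noncomputable section

open MeasureTheory Filter Topology NormedSpace
open scoped Matrix.Norms.Frobenius Matrix
open Literature.MathematicalPhysics.QuantumFieldTheory
open Summit.QuantumFields.YangMills.Cruxes.CurvatureAmnesia.WardDefect.SchwingerDyson

namespace Summit.QuantumFields.GaugeBoot

variable {d L N : ℕ} {G : Type} [Group G] {ρ : G →* Matrix (Fin N) (Fin N) ℂ}

/-! ## Edge avoidance -/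

section Avoids

/-- The word `w` read from `z` AVOIDS the edge `e`: no letter of `w` traverses `e` (in either direction).
[folklore] -/
def Word.Avoids (z : Site d L) (w : Word d) (e : Edge d L) : Prop :=
  ∀ (k : ℕ) (st : Step d), w[k]? = some st → st.edge (Word.siteAt z w k) ≠ e

/-- The empty word avoids every edge. [folklore] -/
theorem Word.avoids_nil (z : Site d L) (e : Edge d L) : Word.Avoids z ([] : Word d) e := by
  intro k st hk; simp at hk

/-- A word avoids `e` if its first letter does and the rest, read from the next site, does. [folklore] -/
theorem Word.avoids_cons {z : Site d L} {e : Edge d L} {st : Step d} {w : Word d} (h0 : st.edge z ≠ e)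
    (hw : Word.Avoids (st.apply z) w e) : Word.Avoids z (st :: w) e := by
  intro k st' hk
  cases k with
  | zero =>
    simp only [List.getElem?_cons_zero, Option.some.injEq] at hk
    subst hk; simpa using h0
  | succ k =>
    simp only [List.getElem?_cons_succ] at hk
    rw [Word.siteAt_succ_cons]
    exact hw k st' hk

/-- Uncons: the tail of an avoiding word avoids (from the next site). [folklore] -/
theorem Word.Avoids.tail {z : Site d L} {e : Edge d L} {st : Step d} {w : Word d} (h : Word.Avoids z (st :: w) e) :
    Word.Avoids (st.apply z) w e := fun k st' hk => by
  have := h (k + 1) st' (by simpa using hk)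
  rwa [Word.siteAt_succ_cons] at this

/-- Uncons: the first letter of an avoiding word does not traverse the edge. [folklore] -/
theorem Word.Avoids.head {z : Site d L} {e : Edge d L} {st : Step d} {w : Word d} (h : Word.Avoids z (st :: w) e) :
    st.edge z ≠ e := by
  simpa using h 0 st (by simp)

/-- Concatenation of avoiding words avoids. [folklore] -/
theorem Word.avoids_append {e : Edge d L} : ∀ {z : Site d L} {u q : Word d}, Word.Avoids z u e →
    Word.Avoids (Word.endpoint z u) q e → Word.Avoids z (u ++ q) e
  | z, [], q, _, hq => by simpa using hq
  | z, st :: u, q, hu, hq => by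
    rw [List.cons_append]
    exact Word.avoids_cons hu.head (Word.avoids_append hu.tail (by simpa using hq))

/-- Transport of avoidance along an equality of base points. [folklore] -/
theorem Word.Avoids.of_eq {z z' : Site d L} {w : Word d} {e : Edge d L} (h : Word.Avoids z w e) (hz : z = z') :
    Word.Avoids z' w e := hz ▸ h

/-- A letter along an axis different from that of the edge does not traverse it. [folklore] -/
theorem Step.edge_ne_of_axis_ne {st : Step d} {z y : Site d L} {κ : Fin d} (h : st.axis ≠ κ) : st.edge z ≠ (y, κ) := by
  cases st with
  | fwd a => simp only [Step.axis_fwd] at h; simp [Step.edge, h]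
  | bwd a => simp only [Step.axis_bwd] at h; simp [Step.edge, h]

/-- A forward letter from `z ≠ y` does not traverse `(y, κ)`. [folklore] -/
theorem Step.fwd_edge_ne {a κ : Fin d} {z y : Site d L} (h : z ≠ y) : (Step.fwd a).edge z ≠ (y, κ) :=
  fun h' => h (congrArg Prod.fst h')

/-- A backward letter `−a` from `z` with `z − e_a ≠ y` does not traverse `(y, κ)`. [folklore] -/
theorem Step.bwd_edge_ne {a κ : Fin d} {z y : Site d L} (h : z - Pi.single a 1 ≠ y) : (Step.bwd a).edge z ≠ (y, κ) :=
  fun h' => h (congrArg Prod.fst h')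

/-- Sites differing in one coordinate differ. [folklore] -/
theorem site_ne_of_apply_ne {z y : Site d L} (i : Fin d) (h : z i ≠ y i) : z ≠ y := fun e => h (congrFun e i)

/-- In `ℤ/L` with `L ≥ 2`: `a − b = 1 ⇒ a ≠ b`. [folklore] -/
theorem zmod_ne_of_sub_eq_one (hL : (1 : ZMod L) ≠ 0) {a b : ZMod L} (h : a - b = 1) : a ≠ b := by
  rintro rfl; exact hL (by rw [← h, sub_self])

/-- In `ℤ/L` with `L ≥ 2`: `a − b = −1 ⇒ a ≠ b`. [folklore] -/
theorem zmod_ne_of_sub_eq_neg_one (hL : (1 : ZMod L) ≠ 0) {a b : ZMod L} (h : a - b = -1) : a ≠ b := by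
  rintro rfl; exact hL (by rw [sub_self] at h; exact (neg_eq_zero.1 h.symm))

end Avoids

/-! ## Vanishing of split and merge terms at non-traversals; the one-marked-letter split sum; rotation -/

section Terms

/-- A split term vanishes at a letter that does not traverse the marked edge. [folklore] -/
theorem splitTerm_eq_zero_of_edge_ne (s : ℂ) (x : Site d L) (μ : Fin d) (U : GaugeConfig d L G) {w : Word d} {k : ℕ}
    {st : Step d} (hk : w[k]? = some st) (hne : st.edge (Word.siteAt x w k) ≠ (x, μ)) : splitTerm ρ s x μ U w k = 0 := by
  unfold splitTerm; rw [hk]; simp only [hne, if_false]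

/-- A merge term vanishes at a spectator letter that does not traverse the marked edge. [folklore] -/
theorem mergeTerm_eq_zero_of_edge_ne (s : ℂ) (x : Site d L) (μ : Fin d) (U : GaugeConfig d L G) (w : Word d)
    (x₁ : Site d L) {v : Word d} {k : ℕ} {st : Step d} (hk : v[k]? = some st)
    (hne : st.edge (Word.siteAt x₁ v k) ≠ (x, μ)) : mergeTerm ρ s x μ U w x₁ v k = 0 := by
  unfold mergeTerm; rw [hk]; simp only [hne, if_false]

/-- **All merge terms vanish for a spectator avoiding the marked edge.** [folklore] -/
theorem sum_mergeTerm_eq_zero_of_avoids (s : ℂ) (x : Site d L) (μ : Fin d) (U : GaugeConfig d L G) (w : Word d)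
    (x₁ : Site d L) {v : Word d} (hv : Word.Avoids x₁ v (x, μ)) :
    ∑ k ∈ Finset.range v.length, mergeTerm ρ s x μ U w x₁ v k = 0 := by
  refine Finset.sum_eq_zero fun k hk => ?_
  obtain ⟨st, hst⟩ : ∃ st, v[k]? = some st := by
    rw [Finset.mem_range] at hk
    exact ⟨v[k], List.getElem?_eq_getElem hk⟩
  exact mergeTerm_eq_zero_of_edge_ne s x μ U w x₁ hst (hv k st hst)

variable (ρ) in
/-- **The one-marked-letter split sum.** For the word `+κ · v` read from `y` whose tail `v` avoids `(y, κ)`: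
`Σ_k splitTerm_k = (N − s/N)·tr ρ(hol(+κ · v))` — only the marked first letter contributes (`tr 1 = N` for the empty
prefix). [folklore] -/
theorem sum_splitTerm_cons_fwd (s : ℂ) (y : Site d L) (κ : Fin d) (U : GaugeConfig d L G) {v : Word d}
    (hv : Word.Avoids (y.shift κ) v (y, κ)) :
    ∑ k ∈ Finset.range (Step.fwd κ :: v : Word d).length, splitTerm ρ s y κ U (.fwd κ :: v) k =
      ((N : ℂ) - s / N) * (ρ (wordHolonomy U y (.fwd κ :: v))).trace := by
  rw [List.length_cons, Finset.sum_range_succ']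
  have h0 : splitTerm ρ s y κ U (.fwd κ :: v) 0 = ((N : ℂ) - s / N) * (ρ (wordHolonomy U y (.fwd κ :: v))).trace := by
    unfold splitTerm
    simp only [List.getElem?_cons_zero, Word.siteAt_zero, Step.edge_fwd, if_true, Step.isFwd_fwd, List.take_zero,
      wordHolonomy_nil, map_one, Matrix.trace_one, Fintype.card_fin, List.drop_zero]
    ring
  have hk : ∀ k ∈ Finset.range v.length, splitTerm ρ s y κ U (.fwd κ :: v) (k + 1) = 0 := fun k hk => by
    obtain ⟨st, hst⟩ : ∃ st, v[k]? = some st := by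
      rw [Finset.mem_range] at hk
      exact ⟨v[k], List.getElem?_eq_getElem hk⟩
    refine splitTerm_eq_zero_of_edge_ne s y κ U (w := .fwd κ :: v) (by simpa using hst) ?_
    rw [Word.siteAt_succ_cons]
    exact hv k st hst
  rw [Finset.sum_eq_zero hk, zero_add, h0]

/-- **Rotation** (a private copy of `PairTraceClasses.trace_wordHolonomy_rotate`, whose module is outside this
file's import closure).  The trace of the holonomy of a CLOSED word is unchanged when its first letter is moved to
the end (and the base point along): `tr ρ(hol_x(st · w)) = tr ρ(hol_{st(x)}(w · st))`. [folklore] -/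
private theorem trace_wordHolonomy_rotate_aux (U : GaugeConfig d L G) (x : Site d L) (st : Step d) (w : Word d)
    (hw : Word.endpoint x (st :: w) = x) :
    (ρ (wordHolonomy U x (st :: w))).trace = (ρ (wordHolonomy U (st.apply x) (w ++ [st]))).trace := by
  have hend : Word.endpoint (st.apply x) w = x := by simpa using hw
  simp only [wordHolonomy_cons, wordHolonomy_append, hend, wordHolonomy_nil, mul_one, map_mul]
  rw [Matrix.trace_mul_comm]

/-- `P̃₀ · q = +μ · (+ν₀ −μ −ν₀ · q)` as lists. [folklore] -/
theorem plaqWord_true_append (μ ν₀ : Fin d) (q : Word d) :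
    plaqWord μ ν₀ true ++ q = .fwd μ :: (.fwd ν₀ :: .bwd μ :: .bwd ν₀ :: q) := rfl

/-- **Rotation of the deformed plaquette words**: for `q` closed at `x`,
`tr ρ(hol_x(P̃₀ · q)) = tr ρ(hol_{x+e_μ}(+ν₀ −μ −ν₀ · q · +μ))`. [folklore] -/
theorem trace_wordHolonomy_plaqWord_append (U : GaugeConfig d L G) (x : Site d L) (μ ν₀ : Fin d) (q : Word d)
    (hq : Word.endpoint x q = x) :
    (ρ (wordHolonomy U x (plaqWord μ ν₀ true ++ q))).trace =
      (ρ (wordHolonomy U (x.shift μ) (.fwd ν₀ :: .bwd μ :: .bwd ν₀ :: (q ++ [.fwd μ])))).trace := by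
  have hcl : Word.endpoint x (Step.fwd μ :: (.fwd ν₀ :: .bwd μ :: .bwd ν₀ :: q) : Word d) = x := by
    rw [← plaqWord_true_append, Word.endpoint_append, endpoint_plaqWord, hq]
  rw [plaqWord_true_append, trace_wordHolonomy_rotate_aux U x _ _ hcl]
  rfl

/-- The rotated deformed word is closed at `x + e_μ` (for `q` closed at `x`). [folklore] -/
theorem endpoint_rot (x : Site d L) (μ ν₀ : Fin d) (q : Word d) (hq : Word.endpoint x q = x) :
    Word.endpoint (x.shift μ) (.fwd ν₀ :: .bwd μ :: .bwd ν₀ :: (q ++ [.fwd μ]) : Word d) = x.shift μ := by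
  have e : (x.shift μ).shift ν₀ - Pi.single μ 1 - Pi.single ν₀ 1 = x := by simp only [Site.shift]; abel
  simp [Word.endpoint_append, e, hq]

end Terms

/-! ## The plaquette words through `(x, μ)` avoid the edge `(x + e_μ, ν₀)` -/

section PlaquetteWords

/-- `P̃_{ν,+}⁻¹ = +ν +μ −ν −μ`. [folklore] -/
theorem plaqWord_true_reverse (μ ν : Fin d) : (plaqWord μ ν true).reverse = [.fwd ν, .fwd μ, .bwd ν, .bwd μ] := rfl

/-- `P̃_{ν,−}⁻¹ = −ν +μ +ν −μ`. [folklore] -/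
theorem plaqWord_false_reverse (μ ν : Fin d) : (plaqWord μ ν false).reverse = [.bwd ν, .fwd μ, .fwd ν, .bwd μ] := rfl

/-- `P̃_{ν,+} = +μ +ν −μ −ν` (read from `x`) avoids `(x + e_μ, ν₀)` when `ν ≠ ν₀`. [folklore] -/
theorem avoids_plaqWord_true (hL : (1 : ZMod L) ≠ 0) (x : Site d L) {μ ν₀ ν : Fin d} (hμν₀ : μ ≠ ν₀)
    (hνν₀ : ν ≠ ν₀) : Word.Avoids x (plaqWord μ ν true) (x.shift μ, ν₀) :=
  Word.avoids_cons (Step.edge_ne_of_axis_ne hμν₀) <|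
  Word.avoids_cons (Step.edge_ne_of_axis_ne hνν₀) <|
  Word.avoids_cons (Step.edge_ne_of_axis_ne hμν₀) <|
  Word.avoids_cons (Step.bwd_edge_ne (site_ne_of_apply_ne μ (by
    simp only [Step.apply_fwd, Step.apply_bwd, Site.shift, Pi.add_apply, Pi.sub_apply, Pi.single_eq_same]
    by_cases h : μ = ν
    · subst h; simp only [Pi.single_eq_same]; exact zmod_ne_of_sub_eq_neg_one hL (by ring)
    · simp only [Pi.single_eq_of_ne h]; exact zmod_ne_of_sub_eq_neg_one hL (by ring)))) <|
  Word.avoids_nil _ _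

/-- `P̃_{ν,−} = +μ −ν −μ +ν` (read from `x`) avoids `(x + e_μ, ν₀)` when `ν ≠ μ` (`ν = ν₀` allowed). [folklore] -/
theorem avoids_plaqWord_false (hL : (1 : ZMod L) ≠ 0) (x : Site d L) {μ ν₀ ν : Fin d} (hμν₀ : μ ≠ ν₀)
    (hμν : μ ≠ ν) : Word.Avoids x (plaqWord μ ν false) (x.shift μ, ν₀) :=
  Word.avoids_cons (Step.edge_ne_of_axis_ne hμν₀) <|
  Word.avoids_cons (Step.bwd_edge_ne (site_ne_of_apply_ne ν (by
    simp only [Step.apply_fwd, Site.shift, Pi.add_apply, Pi.sub_apply, Pi.single_eq_same, Pi.single_eq_of_ne hμν.symm]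
    exact zmod_ne_of_sub_eq_neg_one hL (by ring)))) <|
  Word.avoids_cons (Step.edge_ne_of_axis_ne hμν₀) <|
  Word.avoids_cons (Step.fwd_edge_ne (site_ne_of_apply_ne μ (by
    simp only [Step.apply_fwd, Step.apply_bwd, Site.shift, Pi.add_apply, Pi.sub_apply, Pi.single_eq_same,
      Pi.single_eq_of_ne hμν]
    exact zmod_ne_of_sub_eq_neg_one hL (by ring)))) <|
  Word.avoids_nil _ _

/-- `P̃_{ν,+}⁻¹ = +ν +μ −ν −μ` (read from `x`) avoids `(x + e_μ, ν₀)` when `ν ≠ ν₀`. [folklore] -/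
theorem avoids_plaqWord_true_reverse (hL : (1 : ZMod L) ≠ 0) (x : Site d L) {μ ν₀ ν : Fin d} (hμν₀ : μ ≠ ν₀)
    (hνν₀ : ν ≠ ν₀) : Word.Avoids x (plaqWord μ ν true).reverse (x.shift μ, ν₀) := by
  rw [plaqWord_true_reverse]
  exact Word.avoids_cons (Step.fwd_edge_ne (site_ne_of_apply_ne μ (by
      simp only [Site.shift, Pi.add_apply, Pi.single_eq_same]
      exact zmod_ne_of_sub_eq_neg_one hL (by ring)))) <|
    Word.avoids_cons (Step.edge_ne_of_axis_ne hμν₀) <|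
    Word.avoids_cons (Step.edge_ne_of_axis_ne hνν₀) <|
    Word.avoids_cons (Step.edge_ne_of_axis_ne hμν₀) <|
    Word.avoids_nil _ _

/-- `P̃_{ν,−}⁻¹ = −ν +μ +ν −μ` (read from `x`) avoids `(x + e_μ, ν₀)` when `ν ≠ μ`. [folklore] -/
theorem avoids_plaqWord_false_reverse (hL : (1 : ZMod L) ≠ 0) (x : Site d L) {μ ν₀ ν : Fin d} (hμν₀ : μ ≠ ν₀)
    (hμν : μ ≠ ν) : Word.Avoids x (plaqWord μ ν false).reverse (x.shift μ, ν₀) := by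
  rw [plaqWord_false_reverse]
  exact Word.avoids_cons (Step.bwd_edge_ne (site_ne_of_apply_ne μ (by
      simp only [Site.shift, Pi.add_apply, Pi.sub_apply, Pi.single_eq_same, Pi.single_eq_of_ne hμν]
      exact zmod_ne_of_sub_eq_neg_one hL (by ring)))) <|
    Word.avoids_cons (Step.edge_ne_of_axis_ne hμν₀) <|
    Word.avoids_cons (Step.fwd_edge_ne (site_ne_of_apply_ne ν (by
      simp only [Step.apply_fwd, Step.apply_bwd, Site.shift, Pi.add_apply, Pi.sub_apply, Pi.single_eq_same,
        Pi.single_eq_of_ne hμν.symm]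
      exact zmod_ne_of_sub_eq_neg_one hL (by ring)))) <|
    Word.avoids_cons (Step.edge_ne_of_axis_ne hμν₀) <|
    Word.avoids_nil _ _

/-- **The plaquette words through `(x, μ)` other than `P̃₀` avoid `(x + e_μ, ν₀)`**: for `(ν, ε) ≠ (ν₀, +)`, `ν ≠ μ`.
[folklore] -/
theorem avoids_plaqWord (hL : (1 : ZMod L) ≠ 0) (x : Site d L) {μ ν₀ ν : Fin d} (hμν₀ : μ ≠ ν₀) (hμν : μ ≠ ν)
    {ε : Bool} (hne : ¬(ν = ν₀ ∧ ε = true)) : Word.Avoids x (plaqWord μ ν ε) (x.shift μ, ν₀) := by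
  cases ε with
  | true => exact avoids_plaqWord_true hL x hμν₀ fun h => hne ⟨h, rfl⟩
  | false => exact avoids_plaqWord_false hL x hμν₀ hμν

/-- … and so do their reverses. [folklore] -/
theorem avoids_plaqWord_reverse (hL : (1 : ZMod L) ≠ 0) (x : Site d L) {μ ν₀ ν : Fin d} (hμν₀ : μ ≠ ν₀) (hμν : μ ≠ ν)
    {ε : Bool} (hne : ¬(ν = ν₀ ∧ ε = true)) : Word.Avoids x (plaqWord μ ν ε).reverse (x.shift μ, ν₀) := by
  cases ε with
  | true => exact avoids_plaqWord_true_reverse hL x hμν₀ fun h => hne ⟨h, rfl⟩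
  | false => exact avoids_plaqWord_false_reverse hL x hμν₀ hμν

/-- **The tail of the rotated deformed word avoids the marked edge**: if `q` (read from `x`, closed at `x`) avoids
`(x + e_μ, ν₀)` then so does `−μ −ν₀ · q · +μ` read from `x + e_μ + e_ν₀`. [folklore] -/
theorem avoids_rot_tail [NeZero L] (hL : (1 : ZMod L) ≠ 0) (x : Site d L) {μ ν₀ : Fin d} (hμν₀ : μ ≠ ν₀) {q : Word d}
    (hq : Word.Avoids x q (x.shift μ, ν₀)) (hqx : Word.endpoint x q = x) :
    Word.Avoids ((x.shift μ).shift ν₀) (.bwd μ :: .bwd ν₀ :: (q ++ [.fwd μ]) : Word d) (x.shift μ, ν₀) := by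
  have e : (x.shift μ).shift ν₀ - Pi.single μ 1 - Pi.single ν₀ 1 = x := by simp only [Site.shift]; abel
  refine Word.avoids_cons (Step.edge_ne_of_axis_ne hμν₀) (Word.avoids_cons (Step.bwd_edge_ne ?_) ?_)
  · rw [Step.apply_bwd, e]; exact (shift_ne_self hL x μ).symm
  · rw [Step.apply_bwd, Step.apply_bwd, e]
    refine Word.avoids_append hq ?_
    rw [hqx]
    exact Word.avoids_cons (Step.edge_ne_of_axis_ne hμν₀) (Word.avoids_nil _ _)

variable (ρ) in
/-- ★ **Split sum of the rotated deformed plaquette words.**  For `q` read from `x`, closed at `x` and avoiding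
`(x + e_μ, ν₀)` (e.g. `q = P̃_{ν,ε}^{±1}` with `(ν, ε) ≠ (ν₀, +)`): the word `+ν₀ −μ −ν₀ · q · +μ` read from `x + e_μ` has
`Σ_k splitTerm_k = (N − s/N)·tr ρ(hol)` at the edge `(x + e_μ, ν₀)` — one loop-equation step applies to it. [folklore] -/
theorem sum_splitTerm_rot [NeZero L] (hL : (1 : ZMod L) ≠ 0) (s : ℂ) (x : Site d L) {μ ν₀ : Fin d} (hμν₀ : μ ≠ ν₀)
    (U : GaugeConfig d L G) {q : Word d} (hq : Word.Avoids x q (x.shift μ, ν₀)) (hqx : Word.endpoint x q = x) :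
    ∑ k ∈ Finset.range (Step.fwd ν₀ :: .bwd μ :: .bwd ν₀ :: (q ++ [.fwd μ]) : Word d).length,
        splitTerm ρ s (x.shift μ) ν₀ U (.fwd ν₀ :: .bwd μ :: .bwd ν₀ :: (q ++ [.fwd μ])) k =
      ((N : ℂ) - s / N) * (ρ (wordHolonomy U (x.shift μ) (.fwd ν₀ :: .bwd μ :: .bwd ν₀ :: (q ++ [.fwd μ])))).trace :=
  sum_splitTerm_cons_fwd ρ s (x.shift μ) ν₀ U (avoids_rot_tail hL x hμν₀ hq hqx)

end PlaquetteWords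

end Summit.QuantumFields.GaugeBoot

end
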